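import Literature.NumberTheory.GaloisRepresentations.UnramifiedFrameRing
import Literature.NumberTheory.GaloisRepresentations.CompleteLocalFiniteLevels
import Literature.NumberTheory.GaloisRepresentations.LocalFrobeniusDensity
import Literature.NumberTheory.GaloisRepresentations.LocalWeilDatumUnramified
import Literature.NumberTheory.GaloisRepresentations.PstWeilDeligne
import HarnessLib

/-!
# The universal unramified framed lift `Γ_K → GL_n(𝒪_L⟦X_{ij}⟧)`

Let `K` be a non-archimedean local field, `L/ℚ_p` finite inside `ℚ̄_p` with integers `𝒪 = 𝒪_L`,
residue field `k = k_L`, and `R⁰ = 𝒪⟦X_{ij}⟧ = frameRing L n` (`UnramifiedFrameRing`).  For an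
invertible matrix `g ∈ GL_n(k)` — the Frobenius of an unramified residual representation — we
construct the **universal unramified framed lift**

* `univUnit L g ∈ GL_n(R⁰)`, the universal Frobenius matrix `ĝ + (X_{ij})` (`ĝ` an entrywise lift
  of `g` to `𝒪`, `frobMatrixLift`), with residue `g` (`frameResidue_univMatrix`);
* `frameLift hσ₀ g : Γ_K →* GL_n(R⁰)` (for an arithmetic Frobenius `σ₀`), the unique continuous
  homomorphism which is trivial on the inertia group `I_K` and sends `σ₀` to `univUnit L g`
  (`frameLift_frob`, `frameLift_eq_one_of_mem_absInertia`, `isOpen_setOf_frameLift`).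

Construction (Mazur §10 "the unramified case", made explicit): `R⁰/𝔪ᵐ` is finite
(`CompleteLocalFiniteLevels`), so the image `M_m` of the universal matrix in `GL_n(R⁰/𝔪ᵐ)` has
finite order `o_m`; the open normal subgroup `V_m = Fix(μ_{q^{o_m}-1}) ⊇ I_K` of `Γ_K` satisfies
`σ₀ᵇ ∈ V_m ↔ o_m ∣ b` (`frob_pow_mem_fixingRoots_iff`: the Frobenius acts on prime-to-`p` roots
of unity by `ζ ↦ ζ^q`, `IsAbsArithFrob.pow_smul_rootOfUnity`), so `σ ↦ M_mᵃ` for any `a` with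
`(σ₀ᵃ)⁻¹ σ ∈ V_m` (which exists by the density of Frobenius powers,
`exists_forall_smul_eq_pow_and_mem`) is a well-defined homomorphism `Γ_K → GL_n(R⁰/𝔪ᵐ)`
(`levelRep`), compatible in `m`; the limit over `m` (`CompleteLocalRing.limOfCompatible`) is
`frameLift`.  Finally `frameResidue ∘ frameLift = ρ̄` for every continuous unramified
`ρ̄ : Γ_K → GL_n(k)` with `ρ̄(σ₀) = g` (`frameResidue_frameLift`).

No named facts, no `sorry`.

## References

* B. Mazur, *An introduction to the deformation theory of Galois representations* (1997), §10.
* J.-P. Serre, *Local Fields*, GTM 67, Ch. IV §4 Prop. 16 and Cor. 2 (`Gal(K_nr/K) = Ẑ`).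
  [SerreLocalFields1979]
-/

noncomputable section

open IsLocalRing Field ValuativeRel
open scoped MatrixGroups Pointwise

namespace Literature.NumberTheory.GaloisRepresentations

open IsNonarchimedeanLocalField

/-! ### The fixing groups of roots of unity -/

section FixingRoots

variable {K : Type*} [Field K] [ValuativeRel K] [TopologicalSpace K] [IsNonarchimedeanLocalField K]

variable (K) in
/-- `Fix(μ_N) = {σ ∈ Gal(K̄/K) | σ ζ = ζ for all ζ with ζ ^ N = 1}`, a subgroup. [folklore] -/
def fixingRoots (N : ℕ) : Subgroup (absoluteGaloisGroup K) where
  carrier := {σ | ∀ ζ : AlgebraicClosure K, ζ ^ N = 1 → σ • ζ = ζ}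
  one_mem' := fun ζ _ => one_smul _ ζ
  mul_mem' := fun {σ τ} hσ hτ ζ hζ => by rw [mul_smul, hτ ζ hζ, hσ ζ hζ]
  inv_mem' := fun {σ} hσ ζ hζ => by rw [inv_smul_eq_iff, hσ ζ hζ]

omit [ValuativeRel K] [TopologicalSpace K] [IsNonarchimedeanLocalField K] in
/-- Membership in `Fix(μ_N)`. [folklore] -/
theorem mem_fixingRoots_iff {N : ℕ} {σ : absoluteGaloisGroup K} :
    σ ∈ fixingRoots K N ↔ ∀ ζ : AlgebraicClosure K, ζ ^ N = 1 → σ • ζ = ζ :=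
  Iff.rfl

/-- `Fix(μ_N)` is a normal subgroup (`μ_N` is Galois-stable). [folklore] -/
instance fixingRoots_normal (N : ℕ) : (fixingRoots K N).Normal := by
  refine ⟨fun σ hσ τ ζ hζ => ?_⟩
  have h1 : (τ⁻¹ • ζ) ^ N = 1 := by rw [← smul_pow', hζ, smul_one]
  rw [mul_smul, mul_smul, hσ _ h1, smul_inv_smul]

omit [ValuativeRel K] [TopologicalSpace K] [IsNonarchimedeanLocalField K] in
/-- `Fix(μ_M) ≤ Fix(μ_N)` when `N ∣ M`. [folklore] -/
theorem fixingRoots_anti {N M : ℕ} (h : N ∣ M) : fixingRoots K M ≤ fixingRoots K N := by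
  intro σ hσ ζ hζ
  obtain ⟨c, rfl⟩ := h
  exact hσ ζ (by rw [pow_mul, hζ, one_pow])

omit [ValuativeRel K] [TopologicalSpace K] [IsNonarchimedeanLocalField K] in
/-- `Fix(μ_N)` is open (`N ≠ 0`): a finite intersection of stabilisers, which are open in the
Krull topology. [folklore] -/
theorem isOpen_fixingRoots {N : ℕ} (hN : 0 < N) : IsOpen (fixingRoots K N : Set (absoluteGaloisGroup K)) := by
  classical
  have : (fixingRoots K N : Set (absoluteGaloisGroup K)) =
      ⋂ ζ ∈ (Polynomial.nthRoots N (1 : AlgebraicClosure K)).toFinset,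
        (MulAction.stabilizer (absoluteGaloisGroup K) ζ : Set (absoluteGaloisGroup K)) := by
    ext σ
    simp only [SetLike.mem_coe, mem_fixingRoots_iff, Set.mem_iInter, Multiset.mem_toFinset,
      Polynomial.mem_nthRoots hN, MulAction.mem_stabilizer_iff]
  rw [this]
  exact isOpen_biInter_finset fun ζ _ => stabilizer_isOpen_of_isIntegral (K := K) ζ

/-- The inertia group fixes the roots of unity of order prime to `p`. [cite: SerreLocalFields1979, Ch. IV §4 Prop. 16] -/
theorem absInertia_le_fixingRoots {N : ℕ} (hN : IsUnit ((N : ℕ) : 𝒪[K])) : absInertia K ≤ fixingRoots K N :=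
  fun _ hσ => mem_absInertia_iff_smul_rootsOfUnity.1 hσ N hN

/-- **Frobenius powers in `Fix(μ_{q^o - 1})`**: for an arithmetic Frobenius `σ₀` and `o ≥ 1`,
`σ₀ᵇ` fixes the roots of unity of order `q^o - 1` iff `o ∣ b` — `σ₀ᵇ` acts on them by
`ζ ↦ ζ^{qᵇ}`, and a primitive `(q^o - 1)`-th root of unity is fixed by this iff `q^o - 1 ∣ qᵇ - 1`
iff `o ∣ b`. [cite: SerreLocalFields1979, Ch. IV §4 Prop. 16] -/
theorem frob_pow_mem_fixingRoots_iff {σ₀ : absoluteGaloisGroup K} (hσ₀ : IsAbsArithFrob σ₀) {o : ℕ} (ho : 0 < o)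
    (b : ℕ) : σ₀ ^ b ∈ fixingRoots K (residueFieldCard K ^ o - 1) ↔ o ∣ b := by
  have hq : 2 ≤ residueFieldCard K := one_lt_residueFieldCard K
  have hM : IsUnit (((residueFieldCard K ^ o - 1 : ℕ)) : 𝒪[K]) := isUnit_natCast_residueFieldCard_pow_sub_one K ho.ne'
  have h1 : 1 ≤ residueFieldCard K ^ b := Nat.one_le_pow _ _ (by omega)
  constructor
  · intro h
    obtain ⟨ζ, hζ⟩ := LocalWeilDatum.exists_isPrimitiveRoot_residueFieldCard_pow_sub_one K ho
    have hfix := h ζ hζ.pow_eq_one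
    rw [IsAbsArithFrob.pow_smul_rootOfUnity hσ₀ hM b hζ.pow_eq_one] at hfix
    have hζ0 : ζ ≠ 0 := hζ.ne_zero (LocalWeilDatum.residueFieldCard_pow_sub_one_ne_zero K o ho)
    have h2 : ζ ^ (residueFieldCard K ^ b - 1) = 1 := by
      have h3 : ζ ^ (residueFieldCard K ^ b - 1) * ζ = 1 * ζ := by
        rw [← pow_succ, Nat.sub_add_cancel h1, hfix, one_mul]
      exact mul_right_cancel₀ hζ0 h3
    rw [hζ.pow_eq_one_iff_dvd] at h2
    exact (LocalWeilDatum.pow_sub_one_dvd_pow_sub_one_iff hq).1 h2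
  · intro h ζ hζ
    rw [IsAbsArithFrob.pow_smul_rootOfUnity hσ₀ hM b hζ]
    have h2 : residueFieldCard K ^ o - 1 ∣ residueFieldCard K ^ b - 1 :=
      (LocalWeilDatum.pow_sub_one_dvd_pow_sub_one_iff hq).2 h
    obtain ⟨c, hc⟩ := h2
    calc ζ ^ residueFieldCard K ^ b = ζ ^ (residueFieldCard K ^ b - 1) * ζ := by
          rw [← pow_succ, Nat.sub_add_cancel h1]
      _ = ζ := by rw [hc, pow_mul, hζ, one_pow, one_mul]

end FixingRoots

/-! ### The universal Frobenius matrix -/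

section Universal

variable {p : ℕ} [Fact p.Prime] (L : IntermediateField ℚ_[p] (PadicAlgCl p)) [FiniteDimensional ℚ_[p] L] {n : ℕ}

/-- An entrywise lift of a matrix over `k_L` to `𝒪_L`. [folklore] -/
def frobMatrixLift (g : Matrix (Fin n) (Fin n) (ResidueField (intermediateFieldIntegers p L))) :
    Matrix (Fin n) (Fin n) (intermediateFieldIntegers p L) :=
  fun i j => (residue_surjective (g i j)).choose

omit [FiniteDimensional ℚ_[p] L] in
/-- The lift reduces to the given matrix. [folklore] -/
@[simp] theorem residue_frobMatrixLift (g : Matrix (Fin n) (Fin n) (ResidueField (intermediateFieldIntegers p L)))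
    (i j : Fin n) : residue _ (frobMatrixLift L g i j) = g i j :=
  (residue_surjective (g i j)).choose_spec

/-- **The universal Frobenius matrix** `ĝ + (X_{ij}) ∈ M_n(𝒪_L⟦X⟧)`. [folklore] -/
def univMatrix (g : Matrix (Fin n) (Fin n) (ResidueField (intermediateFieldIntegers p L))) :
    Matrix (Fin n) (Fin n) (frameRing L n) :=
  (algebraMap (intermediateFieldIntegers p L) (frameRing L n)).mapMatrix (frobMatrixLift L g) +
    Matrix.of fun i j => frameVar L n (i, j)

/-- The residue of the universal matrix is `g`. [folklore] -/
theorem frameResidue_univMatrix (g : Matrix (Fin n) (Fin n) (ResidueField (intermediateFieldIntegers p L))) (i j : Fin n) :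
    frameResidue L n (univMatrix L g i j) = g i j := by
  simp only [univMatrix, Matrix.add_apply, RingHom.mapMatrix_apply, Matrix.map_apply, Matrix.of_apply, map_add,
    AlgHom.commutes, IsLocalRing.ResidueField.algebraMap_eq, residue_frobMatrixLift]
  rw [(mem_maximalIdeal_frameRing_iff L n _).1 (frameVar_mem_maximalIdeal L n (i, j)), add_zero]

/-- The residue of the universal matrix, in matrix form. [folklore] -/
theorem mapMatrix_frameResidue_univMatrix (g : Matrix (Fin n) (Fin n) (ResidueField (intermediateFieldIntegers p L))) :
    (frameResidue L n).toRingHom.mapMatrix (univMatrix L g) = g :=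
  Matrix.ext fun i j => frameResidue_univMatrix L g i j

/-- **The universal Frobenius matrix is invertible** when `g` is. [folklore] -/
theorem isUnit_univMatrix (g : GL (Fin n) (ResidueField (intermediateFieldIntegers p L))) :
    IsUnit (univMatrix L (g : Matrix (Fin n) (Fin n) (ResidueField (intermediateFieldIntegers p L)))) := by
  rw [Matrix.isUnit_iff_isUnit_det]
  by_contra h
  have hmem : (univMatrix L (g : Matrix (Fin n) (Fin n) _)).det ∈ maximalIdeal (frameRing L n) :=
    (IsLocalRing.mem_maximalIdeal _).2 h
  rw [mem_maximalIdeal_frameRing_iff] at hmem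
  have h2 : frameResidue L n (univMatrix L (g : Matrix (Fin n) (Fin n) _)).det =
      (g : Matrix (Fin n) (Fin n) (ResidueField (intermediateFieldIntegers p L))).det := by
    rw [show frameResidue L n (univMatrix L (g : Matrix (Fin n) (Fin n) _)).det =
      (frameResidue L n).toRingHom (univMatrix L (g : Matrix (Fin n) (Fin n) _)).det from rfl,
      RingHom.map_det, mapMatrix_frameResidue_univMatrix]
  rw [h2] at hmem
  exact (Matrix.isUnit_iff_isUnit_det _ |>.1 g.isUnit).ne_zero hmem

/-- **The universal Frobenius** `univUnit L g ∈ GL_n(𝒪_L⟦X⟧)`. [folklore] -/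
def univUnit (g : GL (Fin n) (ResidueField (intermediateFieldIntegers p L))) : GL (Fin n) (frameRing L n) :=
  (isUnit_univMatrix L g).unit

/-- The matrix of `univUnit`. [folklore] -/
@[simp] theorem coe_univUnit (g : GL (Fin n) (ResidueField (intermediateFieldIntegers p L))) :
    ((univUnit L g : GL (Fin n) (frameRing L n)) : Matrix (Fin n) (Fin n) (frameRing L n)) =
      univMatrix L (g : Matrix (Fin n) (Fin n) _) :=
  (isUnit_univMatrix L g).unit_spec

/-! ### Finite levels -/

variable (n) in
/-- The level `R⁰/𝔪ᵐ`. [folklore] -/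
abbrev levelQuot (m : ℕ) : Type :=
  frameRing L n ⧸ maximalIdeal (frameRing L n) ^ m

/-- `R⁰/𝔪ᵐ` is finite. [folklore] -/
instance finite_frameRing_quotient (m : ℕ) : Finite (levelQuot L n m) :=
  CompleteLocalRing.finite_quotient_maximalIdeal_pow m

/-- `GL_n(R⁰/𝔪ᵐ)` is finite. [folklore] -/
instance finite_gl_frameRing_quotient (m : ℕ) : Finite (GL (Fin n) (levelQuot L n m)) :=
  CompleteLocalRing.finite_generalLinearGroup_quotient m (Fin n)

variable (n) in
/-- Reduction `GL_n(R⁰) → GL_n(R⁰/𝔪ᵐ)`. [folklore] -/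
def toLevel (m : ℕ) : GL (Fin n) (frameRing L n) →* GL (Fin n) (levelQuot L n m) :=
  Matrix.GeneralLinearGroup.map (Ideal.Quotient.mk (maximalIdeal (frameRing L n) ^ m))

/-- Entries of `toLevel`. [folklore] -/
@[simp] theorem toLevel_apply_coe (m : ℕ) (u : GL (Fin n) (frameRing L n)) (i j : Fin n) :
    ((toLevel L n m u : GL (Fin n) (levelQuot L n m)) : Matrix (Fin n) (Fin n) (levelQuot L n m)) i j =
      Ideal.Quotient.mk (maximalIdeal (frameRing L n) ^ m) ((u : Matrix (Fin n) (Fin n) (frameRing L n)) i j) :=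
  rfl

variable (n) in
/-- The transition map `GL_n(R⁰/𝔪ᵐ⁺¹) → GL_n(R⁰/𝔪ᵐ)`. [folklore] -/
def levelTransition (m : ℕ) : GL (Fin n) (levelQuot L n (m + 1)) →* GL (Fin n) (levelQuot L n m) :=
  Matrix.GeneralLinearGroup.map
    (Ideal.Quotient.factor (Ideal.pow_le_pow_right (Nat.le_succ m) :
      maximalIdeal (frameRing L n) ^ (m + 1) ≤ maximalIdeal (frameRing L n) ^ m))

/-- Entries of `levelTransition`. [folklore] -/
@[simp] theorem levelTransition_apply_coe (m : ℕ) (u : GL (Fin n) (levelQuot L n (m + 1))) (i j : Fin n) :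
    ((levelTransition L n m u : GL (Fin n) (levelQuot L n m)) : Matrix (Fin n) (Fin n) (levelQuot L n m)) i j =
      Ideal.Quotient.factor (Ideal.pow_le_pow_right (Nat.le_succ m))
        ((u : Matrix (Fin n) (Fin n) (levelQuot L n (m + 1))) i j) :=
  rfl

/-- Transition after reduction is reduction. [folklore] -/
theorem levelTransition_toLevel (m : ℕ) (x : GL (Fin n) (frameRing L n)) :
    levelTransition L n m (toLevel L n (m + 1) x) = toLevel L n m x := by
  refine Units.ext (Matrix.ext fun i j => ?_)
  rw [levelTransition_apply_coe, toLevel_apply_coe, toLevel_apply_coe, Ideal.Quotient.factor_mk]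

/-- The order `o_m` of the universal Frobenius modulo `𝔪ᵐ`. [folklore] -/
def levelOrder (g : GL (Fin n) (ResidueField (intermediateFieldIntegers p L))) (m : ℕ) : ℕ :=
  orderOf (toLevel L n m (univUnit L g))

/-- `o_m ≥ 1`. [folklore] -/
theorem levelOrder_pos (g : GL (Fin n) (ResidueField (intermediateFieldIntegers p L))) (m : ℕ) : 0 < levelOrder L g m := by
  haveI : Finite (GL (Fin n) (levelQuot L n m)) := finite_gl_frameRing_quotient L m
  exact Nat.pos_of_dvd_of_pos (orderOf_dvd_natCard (toLevel L n m (univUnit L g))) Nat.card_pos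

/-- `o_m ∣ o_{m+1}`. [folklore] -/
theorem levelOrder_dvd_succ (g : GL (Fin n) (ResidueField (intermediateFieldIntegers p L))) (m : ℕ) :
    levelOrder L g m ∣ levelOrder L g (m + 1) := by
  rw [levelOrder, levelOrder, ← levelTransition_toLevel]
  exact orderOf_map_dvd _ _

/-- `x ^ b = 1` at level `m` iff `o_m ∣ b`, for the universal Frobenius. [folklore] -/
theorem toLevel_univUnit_pow_eq_one_iff (g : GL (Fin n) (ResidueField (intermediateFieldIntegers p L))) (m b : ℕ) :
    toLevel L n m (univUnit L g) ^ b = 1 ↔ levelOrder L g m ∣ b :=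
  (orderOf_dvd_iff_pow_eq_one).symm

end Universal

/-! ### The level representations and the universal lift -/

section Lift

variable {K : Type*} [Field K] [ValuativeRel K] [TopologicalSpace K] [IsNonarchimedeanLocalField K]
  {p : ℕ} [Fact p.Prime] (L : IntermediateField ℚ_[p] (PadicAlgCl p)) [FiniteDimensional ℚ_[p] L] {n : ℕ}
  {σ₀ : absoluteGaloisGroup K} (hσ₀ : IsAbsArithFrob σ₀)
  (g : GL (Fin n) (ResidueField (intermediateFieldIntegers p L)))

variable (K) in
/-- The open normal subgroup `V_m = Fix(μ_{q^{o_m}-1}) ⊇ I_K`. [folklore] -/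
def levelSubgroup (m : ℕ) : Subgroup (absoluteGaloisGroup K) :=
  fixingRoots K (residueFieldCard K ^ levelOrder L g m - 1)

variable (K) in
/-- `V_m` is open. [folklore] -/
theorem isOpen_levelSubgroup (m : ℕ) : IsOpen (levelSubgroup K L g m : Set (absoluteGaloisGroup K)) :=
  isOpen_fixingRoots (Nat.pos_of_ne_zero (LocalWeilDatum.residueFieldCard_pow_sub_one_ne_zero K _ (levelOrder_pos L g m)))

variable (K) in
/-- `I_K ≤ V_m`. [folklore] -/
theorem absInertia_le_levelSubgroup (m : ℕ) : absInertia K ≤ levelSubgroup K L g m :=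
  absInertia_le_fixingRoots (isUnit_natCast_residueFieldCard_pow_sub_one K (levelOrder_pos L g m).ne')

variable (K) in
/-- `V_{m+1} ≤ V_m`. [folklore] -/
theorem levelSubgroup_succ_le (m : ℕ) : levelSubgroup K L g (m + 1) ≤ levelSubgroup K L g m :=
  fixingRoots_anti ((LocalWeilDatum.pow_sub_one_dvd_pow_sub_one_iff (one_lt_residueFieldCard K)).2
    (levelOrder_dvd_succ L g m))

include hσ₀ in
/-- `σ₀ᵇ ∈ V_m ↔ o_m ∣ b`. [folklore] -/
theorem frob_pow_mem_levelSubgroup_iff (m b : ℕ) : σ₀ ^ b ∈ levelSubgroup K L g m ↔ levelOrder L g m ∣ b :=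
  frob_pow_mem_fixingRoots_iff hσ₀ (levelOrder_pos L g m) b

include hσ₀ in
/-- Every `σ` is `σ₀ᵃ` modulo `V_m` for some `a : ℕ` (density of Frobenius powers). [folklore] -/
theorem exists_exponent (m : ℕ) (σ : absoluteGaloisGroup K) : ∃ a : ℕ, (σ₀ ^ a)⁻¹ * σ ∈ levelSubgroup K L g m := by
  obtain ⟨a, -, ha⟩ := exists_forall_smul_eq_pow_and_mem hσ₀ σ ∅ (by simp) (isOpen_levelSubgroup K L g m)
    (absInertia_le_levelSubgroup K L g m)
  exact ⟨a, ha⟩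

/-- A chosen exponent `a(σ, m)` with `(σ₀ᵃ)⁻¹ σ ∈ V_m`. [folklore] -/
def exponent (m : ℕ) (σ : absoluteGaloisGroup K) : ℕ :=
  (exists_exponent L hσ₀ g m σ).choose

/-- Defining property of `exponent`. [folklore] -/
theorem exponent_spec (m : ℕ) (σ : absoluteGaloisGroup K) :
    (σ₀ ^ exponent L hσ₀ g m σ)⁻¹ * σ ∈ levelSubgroup K L g m :=
  (exists_exponent L hσ₀ g m σ).choose_spec

/-- **The level-`m` representation** `σ ↦ M_m^{a(σ,m)} : Γ_K → GL_n(R⁰/𝔪ᵐ)`. [folklore] -/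
def levelRep (m : ℕ) (σ : absoluteGaloisGroup K) : GL (Fin n) (levelQuot L n m) :=
  toLevel L n m (univUnit L g) ^ exponent L hσ₀ g m σ

include hσ₀ in
/-- Powers of the universal Frobenius agree for exponents differing by an element of `V_m`. [folklore] -/
theorem toLevel_pow_eq_of_mem {m a b : ℕ} (h : (σ₀ ^ a)⁻¹ * σ₀ ^ b ∈ levelSubgroup K L g m) :
    toLevel L n m (univUnit L g) ^ a = toLevel L n m (univUnit L g) ^ b := by
  rcases le_total a b with hab | hab
  · obtain ⟨c, rfl⟩ := Nat.exists_eq_add_of_le hab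
    rw [pow_add, inv_mul_cancel_left] at h
    have h1 := (toLevel_univUnit_pow_eq_one_iff L g m c).2 ((frob_pow_mem_levelSubgroup_iff L hσ₀ g m c).1 h)
    rw [pow_add, h1, mul_one]
  · obtain ⟨c, rfl⟩ := Nat.exists_eq_add_of_le hab
    have h' : σ₀ ^ c ∈ levelSubgroup K L g m := by
      rw [pow_add, mul_inv_rev, inv_mul_cancel_right] at h
      exact (Subgroup.inv_mem_iff _).1 h
    have h1 := (toLevel_univUnit_pow_eq_one_iff L g m c).2 ((frob_pow_mem_levelSubgroup_iff L hσ₀ g m c).1 h')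
    rw [pow_add, h1, mul_one]

/-- **Independence of the exponent**: any `a` with `(σ₀ᵃ)⁻¹ σ ∈ V_m` computes `levelRep`. [folklore] -/
theorem levelRep_eq_pow_of_mem {m : ℕ} {σ : absoluteGaloisGroup K} {a : ℕ} (ha : (σ₀ ^ a)⁻¹ * σ ∈ levelSubgroup K L g m) :
    levelRep L hσ₀ g m σ = toLevel L n m (univUnit L g) ^ a := by
  refine toLevel_pow_eq_of_mem L hσ₀ g ?_
  -- `(σ₀^e)⁻¹ σ₀^a = ((σ₀^e)⁻¹ σ) ((σ₀^a)⁻¹ σ)⁻¹`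
  have h := (levelSubgroup K L g m).mul_mem (exponent_spec L hσ₀ g m σ) ((levelSubgroup K L g m).inv_mem ha)
  rwa [mul_inv_rev, inv_inv, mul_assoc, mul_inv_cancel_left] at h

/-- `levelRep 1 = 1`. [folklore] -/
theorem levelRep_one (m : ℕ) : levelRep L hσ₀ g m 1 = 1 := by
  rw [levelRep_eq_pow_of_mem L hσ₀ g (a := 0) (by rw [pow_zero, inv_one, mul_one]; exact one_mem _), pow_zero]

/-- `levelRep σ₀ = M_m`. [folklore] -/
theorem levelRep_frob (m : ℕ) : levelRep L hσ₀ g m σ₀ = toLevel L n m (univUnit L g) := by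
  rw [levelRep_eq_pow_of_mem L hσ₀ g (a := 1) (by rw [pow_one, inv_mul_cancel]; exact one_mem _), pow_one]

/-- `levelRep` is trivial on `V_m` (in particular on `I_K`). [folklore] -/
theorem levelRep_eq_one_of_mem {m : ℕ} {σ : absoluteGaloisGroup K} (hσ : σ ∈ levelSubgroup K L g m) :
    levelRep L hσ₀ g m σ = 1 := by
  rw [levelRep_eq_pow_of_mem L hσ₀ g (a := 0) (by rwa [pow_zero, inv_one, one_mul]), pow_zero]

/-- **`levelRep` is a homomorphism.** [folklore] -/
theorem levelRep_mul (m : ℕ) (σ τ : absoluteGaloisGroup K) :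
    levelRep L hσ₀ g m (σ * τ) = levelRep L hσ₀ g m σ * levelRep L hσ₀ g m τ := by
  set a := exponent L hσ₀ g m σ
  set b := exponent L hσ₀ g m τ
  have ha := exponent_spec L hσ₀ g m σ
  have hb := exponent_spec L hσ₀ g m τ
  -- `(σ₀^(a+b))⁻¹ (σ τ) = ((σ₀^b)⁻¹ ((σ₀^a)⁻¹ σ) σ₀^b) ((σ₀^b)⁻¹ τ) ∈ V_m`
  have hab : (σ₀ ^ (a + b))⁻¹ * (σ * τ) ∈ levelSubgroup K L g m := by
    have h1 : (σ₀ ^ b)⁻¹ * ((σ₀ ^ a)⁻¹ * σ) * (σ₀ ^ b)⁻¹⁻¹ ∈ levelSubgroup K L g m :=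
      (fixingRoots_normal _).conj_mem _ ha _
    have h2 := (levelSubgroup K L g m).mul_mem h1 hb
    have h3 : (σ₀ ^ b)⁻¹ * ((σ₀ ^ a)⁻¹ * σ) * (σ₀ ^ b)⁻¹⁻¹ * ((σ₀ ^ b)⁻¹ * τ) = (σ₀ ^ (a + b))⁻¹ * (σ * τ) := by
      rw [inv_inv, pow_add, mul_inv_rev]
      group
    rwa [h3] at h2
  rw [levelRep_eq_pow_of_mem L hσ₀ g hab, pow_add]
  rfl

/-- **Compatibility in the level.** [folklore] -/
theorem levelTransition_levelRep (m : ℕ) (σ : absoluteGaloisGroup K) :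
    levelTransition L n m (levelRep L hσ₀ g (m + 1) σ) = levelRep L hσ₀ g m σ := by
  have ha : (σ₀ ^ exponent L hσ₀ g (m + 1) σ)⁻¹ * σ ∈ levelSubgroup K L g m :=
    levelSubgroup_succ_le K L g m (exponent_spec L hσ₀ g (m + 1) σ)
  rw [levelRep_eq_pow_of_mem L hσ₀ g ha, levelRep, map_pow, levelTransition_toLevel]

/-- Entries of the level representations form compatible families. [folklore] -/
theorem levelRep_entry_compat (σ : absoluteGaloisGroup K) (i j : Fin n) (m : ℕ) :
    Ideal.Quotient.factor (Ideal.pow_le_pow_right (Nat.le_succ m))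
        (((levelRep L hσ₀ g (m + 1) σ : GL (Fin n) (levelQuot L n (m + 1))) : Matrix (Fin n) (Fin n) (levelQuot L n (m + 1))) i j) =
      ((levelRep L hσ₀ g m σ : GL (Fin n) (levelQuot L n m)) : Matrix (Fin n) (Fin n) (levelQuot L n m)) i j := by
  rw [← levelTransition_levelRep L hσ₀ g m σ, levelTransition_apply_coe]

/-- The matrix of the universal lift at `σ`: the limit of the level representations. [folklore] -/
def frameLiftMatrix (σ : absoluteGaloisGroup K) : Matrix (Fin n) (Fin n) (frameRing L n) :=
  fun i j => CompleteLocalRing.limOfCompatible (maximalIdeal (frameRing L n))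
    (fun m => ((levelRep L hσ₀ g m σ : GL (Fin n) (levelQuot L n m)) : Matrix (Fin n) (Fin n) (levelQuot L n m)) i j)
    (levelRep_entry_compat L hσ₀ g σ i j)

/-- **The universal lift reduces to the level representations.** [folklore] -/
theorem mk_frameLiftMatrix (m : ℕ) (σ : absoluteGaloisGroup K) (i j : Fin n) :
    Ideal.Quotient.mk (maximalIdeal (frameRing L n) ^ m) (frameLiftMatrix L hσ₀ g σ i j) =
      ((levelRep L hσ₀ g m σ : GL (Fin n) (levelQuot L n m)) : Matrix (Fin n) (Fin n) (levelQuot L n m)) i j :=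
  CompleteLocalRing.mk_limOfCompatible _ _ _ m

/-- Matrix form of `mk_frameLiftMatrix`. [folklore] -/
theorem mapMatrix_mk_frameLiftMatrix (m : ℕ) (σ : absoluteGaloisGroup K) :
    (Ideal.Quotient.mk (maximalIdeal (frameRing L n) ^ m)).mapMatrix (frameLiftMatrix L hσ₀ g σ) =
      ((levelRep L hσ₀ g m σ : GL (Fin n) (levelQuot L n m)) : Matrix (Fin n) (Fin n) (levelQuot L n m)) :=
  Matrix.ext fun i j => mk_frameLiftMatrix L hσ₀ g m σ i j

/-- Two matrices over `R⁰` with the same reductions are equal. [folklore] -/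
theorem matrix_eq_of_forall_mapMatrix_mk_eq {A B : Matrix (Fin n) (Fin n) (frameRing L n)}
    (h : ∀ m : ℕ, (Ideal.Quotient.mk (maximalIdeal (frameRing L n) ^ m)).mapMatrix A =
      (Ideal.Quotient.mk (maximalIdeal (frameRing L n) ^ m)).mapMatrix B) : A = B :=
  Matrix.ext fun i j => CompleteLocalRing.eq_of_forall_mk_eq (maximalIdeal (frameRing L n)) fun m => by
    have := congrFun (congrFun (h m) i) j
    simpa only [RingHom.mapMatrix_apply, Matrix.map_apply] using this

/-- `frameLiftMatrix (σ τ) = frameLiftMatrix σ * frameLiftMatrix τ`. [folklore] -/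
theorem frameLiftMatrix_mul (σ τ : absoluteGaloisGroup K) :
    frameLiftMatrix L hσ₀ g (σ * τ) = frameLiftMatrix L hσ₀ g σ * frameLiftMatrix L hσ₀ g τ := by
  refine matrix_eq_of_forall_mapMatrix_mk_eq L fun m => ?_
  rw [map_mul, mapMatrix_mk_frameLiftMatrix, mapMatrix_mk_frameLiftMatrix, mapMatrix_mk_frameLiftMatrix,
    levelRep_mul, Units.val_mul]

/-- `frameLiftMatrix 1 = 1`. [folklore] -/
theorem frameLiftMatrix_one : frameLiftMatrix L hσ₀ g (1 : absoluteGaloisGroup K) = 1 := by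
  refine matrix_eq_of_forall_mapMatrix_mk_eq L fun m => ?_
  rw [map_one, mapMatrix_mk_frameLiftMatrix, levelRep_one, Units.val_one]

/-- **The universal unramified framed lift** `Γ_K →* GL_n(𝒪_L⟦X_{ij}⟧)` attached to the
arithmetic Frobenius `σ₀` and the residual Frobenius matrix `g`. [cite: Kisin2007, (3.3.3)] -/
def frameLift : absoluteGaloisGroup K →* GL (Fin n) (frameRing L n) where
  toFun σ := ⟨frameLiftMatrix L hσ₀ g σ, frameLiftMatrix L hσ₀ g σ⁻¹,
    by rw [← frameLiftMatrix_mul, mul_inv_cancel, frameLiftMatrix_one],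
    by rw [← frameLiftMatrix_mul, inv_mul_cancel, frameLiftMatrix_one]⟩
  map_one' := Units.ext (frameLiftMatrix_one L hσ₀ g)
  map_mul' σ τ := Units.ext (frameLiftMatrix_mul L hσ₀ g σ τ)

/-- The matrix of `frameLift σ`. [folklore] -/
@[simp] theorem coe_frameLift (σ : absoluteGaloisGroup K) :
    ((frameLift L hσ₀ g σ : GL (Fin n) (frameRing L n)) : Matrix (Fin n) (Fin n) (frameRing L n)) =
      frameLiftMatrix L hσ₀ g σ :=
  rfl

/-- The reductions of `frameLift`. [folklore] -/
theorem toLevel_frameLift (m : ℕ) (σ : absoluteGaloisGroup K) :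
    toLevel L n m (frameLift L hσ₀ g σ) = levelRep L hσ₀ g m σ :=
  Units.ext (mapMatrix_mk_frameLiftMatrix L hσ₀ g m σ)

/-- **`frameLift σ₀` is the universal Frobenius matrix.** [folklore] -/
theorem frameLift_frob : frameLift L hσ₀ g σ₀ = univUnit L g := by
  refine Units.ext (matrix_eq_of_forall_mapMatrix_mk_eq L fun m => ?_)
  rw [coe_frameLift, mapMatrix_mk_frameLiftMatrix, levelRep_frob]
  rfl

/-- **`frameLift` is trivial on `V_m` modulo `𝔪ᵐ`.** [folklore] -/
theorem toLevel_frameLift_eq_one_of_mem {m : ℕ} {σ : absoluteGaloisGroup K} (hσ : σ ∈ levelSubgroup K L g m) :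
    toLevel L n m (frameLift L hσ₀ g σ) = 1 := by
  rw [toLevel_frameLift, levelRep_eq_one_of_mem L hσ₀ g hσ]

/-- **`frameLift` is unramified**: trivial on the inertia group. [cite: Kisin2007, (3.3.3)] -/
theorem frameLift_eq_one_of_mem_absInertia {σ : absoluteGaloisGroup K} (hσ : σ ∈ absInertia K) :
    frameLift L hσ₀ g σ = 1 := by
  refine Units.ext (matrix_eq_of_forall_mapMatrix_mk_eq L fun m => ?_)
  have h := toLevel_frameLift_eq_one_of_mem L hσ₀ g (absInertia_le_levelSubgroup K L g m hσ)
  have h' := congrArg Units.val h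
  rw [Units.val_one] at h'
  rw [Units.val_one, map_one]
  exact h'

/-- Triviality at level `m` in terms of entries. [folklore] -/
theorem toLevel_eq_one_iff (m : ℕ) (u : GL (Fin n) (frameRing L n)) :
    toLevel L n m u = 1 ↔ ∀ i j : Fin n,
      (u : Matrix (Fin n) (Fin n) (frameRing L n)) i j - (1 : Matrix (Fin n) (Fin n) (frameRing L n)) i j ∈
        maximalIdeal (frameRing L n) ^ m := by
  rw [Units.ext_iff, Units.val_one]
  change (Ideal.Quotient.mk (maximalIdeal (frameRing L n) ^ m)).mapMatrix (u : Matrix (Fin n) (Fin n) (frameRing L n)) = 1 ↔ _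
  rw [← (Ideal.Quotient.mk (maximalIdeal (frameRing L n) ^ m)).mapMatrix.map_one, ← Matrix.ext_iff]
  simp only [RingHom.mapMatrix_apply, Matrix.map_apply, Ideal.Quotient.eq]

/-- The congruence set `{σ | frameLift σ ≡ 1 mod 𝔪ᵐ}` is the kernel of the level-`m` reduction of
`frameLift`. [folklore] -/
theorem setOf_frameLift_congr_eq (m : ℕ) :
    {σ : absoluteGaloisGroup K | ∀ i j : Fin n,
      ((frameLift L hσ₀ g σ : GL (Fin n) (frameRing L n)) : Matrix (Fin n) (Fin n) (frameRing L n)) i j -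
        (1 : Matrix (Fin n) (Fin n) (frameRing L n)) i j ∈ maximalIdeal (frameRing L n) ^ m} =
      (((toLevel L n m).comp (frameLift L hσ₀ g)).ker : Set (absoluteGaloisGroup K)) := by
  ext σ
  rw [Set.mem_setOf_eq, SetLike.mem_coe, MonoidHom.mem_ker, MonoidHom.coe_comp, Function.comp_apply, toLevel_eq_one_iff]

/-- **Continuity of the universal lift** for the `𝔪`-adic topology: each congruence set
`{σ | frameLift σ ≡ 1 mod 𝔪ᵐ}` is open (it is a subgroup containing the open subgroup `V_m`).
[cite: Kisin2007, (3.3.3)] -/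
theorem isOpen_setOf_frameLift (m : ℕ) :
    IsOpen {σ : absoluteGaloisGroup K | ∀ i j : Fin n,
      ((frameLift L hσ₀ g σ : GL (Fin n) (frameRing L n)) : Matrix (Fin n) (Fin n) (frameRing L n)) i j -
        (1 : Matrix (Fin n) (Fin n) (frameRing L n)) i j ∈ maximalIdeal (frameRing L n) ^ m} := by
  rw [setOf_frameLift_congr_eq]
  refine Subgroup.isOpen_mono (H₁ := levelSubgroup K L g m) (fun σ hσ => ?_) (isOpen_levelSubgroup K L g m)
  rw [MonoidHom.mem_ker, MonoidHom.coe_comp, Function.comp_apply]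
  exact toLevel_frameLift_eq_one_of_mem L hσ₀ g hσ

/-! ### Comparison with a residual representation -/

/-- The residue map `R⁰/𝔪¹ → k_L` induced by `frameResidue`. [folklore] -/
def levelOneResidue : levelQuot L n 1 →+* ResidueField (intermediateFieldIntegers p L) :=
  Ideal.Quotient.lift _ (frameResidue L n).toRingHom fun x hx => by
    rw [pow_one] at hx
    exact (mem_maximalIdeal_frameRing_iff L n x).1 hx

/-- `levelOneResidue ∘ mk = frameResidue`. [folklore] -/
@[simp] theorem levelOneResidue_mk (x : frameRing L n) :
    levelOneResidue L (n := n) (Ideal.Quotient.mk _ x) = frameResidue L n x :=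
  Ideal.Quotient.lift_mk _ _ _

/-- At level `1` the universal Frobenius maps to `g`. [folklore] -/
theorem map_levelOneResidue_toLevel_univUnit :
    Matrix.GeneralLinearGroup.map (levelOneResidue L (n := n)) (toLevel L n 1 (univUnit L g)) = g := by
  refine Units.ext (Matrix.ext fun i j => ?_)
  change levelOneResidue L (Ideal.Quotient.mk _ ((univUnit L g : Matrix (Fin n) (Fin n) (frameRing L n)) i j)) = _
  rw [levelOneResidue_mk, coe_univUnit, frameResidue_univMatrix]

/-- `frameResidue ∘ frameLift` factors through the level-`1` representation. [folklore] -/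
theorem mapMatrix_frameResidue_frameLift (σ : absoluteGaloisGroup K) :
    (frameResidue L n).toRingHom.mapMatrix
        ((frameLift L hσ₀ g σ : GL (Fin n) (frameRing L n)) : Matrix (Fin n) (Fin n) (frameRing L n)) =
      ((Matrix.GeneralLinearGroup.map (levelOneResidue L (n := n)) (levelRep L hσ₀ g 1 σ) :
        GL (Fin n) (ResidueField (intermediateFieldIntegers p L))) :
          Matrix (Fin n) (Fin n) (ResidueField (intermediateFieldIntegers p L))) := by
  refine Matrix.ext fun i j => ?_
  change frameResidue L n (frameLiftMatrix L hσ₀ g σ i j) =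
    levelOneResidue L (((levelRep L hσ₀ g 1 σ : GL (Fin n) (levelQuot L n 1)) : Matrix (Fin n) (Fin n) (levelQuot L n 1)) i j)
  rw [← mk_frameLiftMatrix L hσ₀ g 1 σ i j, levelOneResidue_mk]

include hσ₀ in
/-- **`V₁` acts trivially through every continuous unramified `ρ̄` with `ρ̄(σ₀) = g`.** The
kernel of `ρ̄` is open and contains `I_K`; by density some `(σ₀ᵇ)⁻¹ τ` lies in `ker ρ̄ ∩ V₁`, then
`σ₀ᵇ ∈ V₁`, `o₁ ∣ b`, and `ord g ∣ o₁`. [folklore] -/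
theorem residualRep_eq_one_of_mem_levelSubgroup
    (ρbar : absoluteGaloisGroup K →* GL (Fin n) (ResidueField (intermediateFieldIntegers p L)))
    (hunr : absInertia K ≤ ρbar.ker) (hker : IsOpen (ρbar.ker : Set (absoluteGaloisGroup K)))
    (hg : ρbar σ₀ = g) {τ : absoluteGaloisGroup K} (hτ : τ ∈ levelSubgroup K L g 1) : ρbar τ = 1 := by
  have hU : IsOpen ((ρbar.ker ⊓ levelSubgroup K L g 1 : Subgroup (absoluteGaloisGroup K)) : Set (absoluteGaloisGroup K)) :=
    hker.inter (isOpen_levelSubgroup K L g 1)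
  have hIU : (absInertia K : Set (absoluteGaloisGroup K)) ⊆
      ((ρbar.ker ⊓ levelSubgroup K L g 1 : Subgroup (absoluteGaloisGroup K)) : Set (absoluteGaloisGroup K)) :=
    fun σ hσ => Subgroup.mem_inf.2 ⟨hunr hσ, absInertia_le_levelSubgroup K L g 1 hσ⟩
  obtain ⟨b, -, hb⟩ := exists_forall_smul_eq_pow_and_mem hσ₀ τ ∅ (by simp) hU hIU
  obtain ⟨hb1, hb2⟩ := Subgroup.mem_inf.1 hb
  -- `σ₀ ^ b ∈ V₁`
  have hfrob : σ₀ ^ b ∈ levelSubgroup K L g 1 := by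
    have h := (levelSubgroup K L g 1).mul_mem hτ ((levelSubgroup K L g 1).inv_mem hb2)
    rwa [mul_inv_rev, inv_inv, mul_inv_cancel_left] at h
  have hdvd : orderOf g ∣ b := by
    have h1 : orderOf g ∣ levelOrder L g 1 := by
      have h2 := orderOf_map_dvd (Matrix.GeneralLinearGroup.map (levelOneResidue L (n := n))) (toLevel L n 1 (univUnit L g))
      rw [map_levelOneResidue_toLevel_univUnit L g] at h2
      exact h2
    exact h1.trans ((frob_pow_mem_levelSubgroup_iff L hσ₀ g 1 b).1 hfrob)
  have hgb : g ^ b = 1 := orderOf_dvd_iff_pow_eq_one.1 hdvd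
  have hb1' : ρbar ((σ₀ ^ b)⁻¹ * τ) = 1 := (MonoidHom.mem_ker).1 hb1
  have hτeq : ρbar τ = ρbar (σ₀ ^ b * ((σ₀ ^ b)⁻¹ * τ)) := by rw [mul_inv_cancel_left]
  rw [hτeq, map_mul, map_pow, hg, hgb, one_mul, hb1']

/-- **The universal lift reduces to `ρ̄`**: for every continuous unramified
`ρ̄ : Γ_K → GL_n(k_L)` with `ρ̄(σ₀) = g`, `frameResidue ∘ frameLift = ρ̄` entrywise.
[cite: Kisin2007, (3.3.3)] -/
theorem frameResidue_frameLift
    (ρbar : absoluteGaloisGroup K →* GL (Fin n) (ResidueField (intermediateFieldIntegers p L)))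
    (hunr : absInertia K ≤ ρbar.ker) (hker : IsOpen (ρbar.ker : Set (absoluteGaloisGroup K)))
    (hg : ρbar σ₀ = g) (σ : absoluteGaloisGroup K) (i j : Fin n) :
    frameResidue L n (((frameLift L hσ₀ g σ : GL (Fin n) (frameRing L n)) : Matrix (Fin n) (Fin n) (frameRing L n)) i j) =
      ((ρbar σ : GL (Fin n) (ResidueField (intermediateFieldIntegers p L))) :
        Matrix (Fin n) (Fin n) (ResidueField (intermediateFieldIntegers p L))) i j := by
  have h1 := congrFun (congrFun (mapMatrix_frameResidue_frameLift L hσ₀ g σ) i) j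
  simp only [RingHom.mapMatrix_apply, Matrix.map_apply] at h1
  rw [show (frameResidue L n).toRingHom _ = frameResidue L n _ from rfl] at h1
  rw [h1, levelRep, map_pow, map_levelOneResidue_toLevel_univUnit]
  -- `ρ̄ σ = g ^ a`
  have ha := exponent_spec L hσ₀ g 1 σ
  have h2 := residualRep_eq_one_of_mem_levelSubgroup L hσ₀ g ρbar hunr hker hg ha
  have hρσ : ρbar σ = g ^ exponent L hσ₀ g 1 σ := by
    have h3 : ρbar σ = ρbar (σ₀ ^ exponent L hσ₀ g 1 σ * ((σ₀ ^ exponent L hσ₀ g 1 σ)⁻¹ * σ)) := by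
      rw [mul_inv_cancel_left]
    rw [h3, map_mul, map_pow, hg, h2, mul_one]
  rw [hρσ]

end Lift

end Literature.NumberTheory.GaloisRepresentations

end
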